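import Summits.QuantumFields.YangMills.Theorems.BalabanUVNodesPortS1G3CRemainder

/-!
# NODE O port PT-A — `stub_G3C` (repaired edition `G3CAtRecordL`), layer (D4a): WALK-TERM ALGEBRA — the support rule `𝟙_□·T_Y = 0` unless `□ ∈ Y` (so the walks
# `(□₀; (□₁,Y₁), …)` are CONNECTED: `□_{i−1} ∈ Y_i`), entries `≤` the `ℓ²`-operator norm, the rooted trace bound `|Tr[G_{□₀}𝟙_{□₀}·M]| ≤ N_□·‖M‖∕γ₀`
# (`N_□ = 3d(L·Mc)^d`), and `‖S₁⋯Sₘ‖ ≤ Π‖S_i‖` for lists of steps (memo §5c, (g3) majorant)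

Cell `ym-nodeO-ideate`, porter hand `hand-27930-G3C` (g0); proof kind, `--supports stmt-QuantumFields-27930 --as helper`; count-neutral.  [B9] = [Balaban1985BackgroundPropagators], [16] = [Balaban1985UV3].

WHAT THIS FILE PROVES (sorry-free): generic `G3CCT.norm_apply_le_l2_opNorm`, `G3CCT.norm_trace_diagonal_mul_le`, `G3CCT.norm_list_prod_le`; at the record `g3cInd_mul_nonB0Block_of_not_mem`,
`g3cInd_mul_g3cStep_of_not_mem` (connectivity of walks), `g3cStep_mul_g3cInd` (`S_{□,Y}·𝟙_□ = S_{□,Y}`), ★ `norm_trace_root_mul_le` (`|Tr[G_{□₀}𝟙_{□₀}M]| ≤ N_□·(1∕γ₀)·‖M‖`),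
★ `norm_trace_root_mul_prod_le` (the walk-term majorant `|t_ω| ≤ N_□·(1∕γ₀)·Π‖S_i‖`).

HONEST FRAMING.  Elementary bounds under the HYPOTHESIS `P0CarrierClauses …` (inhabited nowhere); nothing of Bałaban's estimates asserted, ported or discharged; `stub_G3C` NOT closed; 27930 OPEN;
NODE O 0∕1; COUNT 8∕28 · K 1∕4 UNMOVED; finite `𝕋⁴_{L^K}` at fixed ε — NOT continuum ∕ OS ∕ Clay; **the Yang–Mills mass gap is NOT proved by any of this.**  No `sorry`, no `instance`, no `notation`,
no `def`; standard axioms.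
-/

noncomputable section

open scoped BigOperators Matrix.Norms.L2Operator Topology Matrix Classical
open Filter Finset WithLp

namespace Summit.QuantumFields.YangMills.Theorems.BalabanUVNodesPortS1

open Summit.QuantumFields.YangMills.Theorems.K0RecordFormatNames
open Literature.MathematicalPhysics.QuantumFieldTheory.Balaban1983to89
open Literature.MathematicalPhysics.QuantumFieldTheory.Balaban1983to89.Node00
open Literature.MathematicalPhysics.QuantumFieldTheory.Balaban1983to89.T4Continuum (T4Family)
open Literature.MathematicalPhysics.QuantumFieldTheory.Balaban1983to89.TreeLengthTorus (TPt)

/-! ## Generic kit -/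

namespace G3CCT

variable {ι : Type*} [Fintype ι] [DecidableEq ι]

/-- **Entries are bounded by the `ℓ²`-operator norm**: `‖A i j‖ ≤ ‖A‖` (test against the basis vector `e_j`). [folklore] -/
theorem norm_apply_le_l2_opNorm (A : Matrix ι ι ℂ) (i j : ι) : ‖A i j‖ ≤ ‖A‖ := by
  set v : EuclideanSpace ℂ ι := PiLp.single 2 j (1 : ℂ) with hv
  have hv1 : ‖v‖ = 1 := by rw [hv, PiLp.norm_single, norm_one]
  have h1 := Matrix.l2_opNorm_mulVec A v
  rw [hv1, mul_one] at h1
  have h2 : ‖((EuclideanSpace.equiv ι ℂ).symm (Matrix.mulVec A v.ofLp)) i‖ ≤ ‖(EuclideanSpace.equiv ι ℂ).symm (Matrix.mulVec A v.ofLp)‖ :=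
    PiLp.norm_apply_le _ i
  have h3 : ((EuclideanSpace.equiv ι ℂ).symm (Matrix.mulVec A v.ofLp)) i = A i j := by
    have : v.ofLp = Pi.single j 1 := by rw [hv]; rfl
    simp [this]
  rw [h3] at h2
  exact h2.trans h1

/-- **Partial traces**: `‖Tr[𝟙_p · M]‖ ≤ #{p} · ‖M‖` for the indicator diagonal `𝟙_p` of a predicate `p`. [folklore] -/
theorem norm_trace_diagonal_mul_le (p : ι → Prop) [DecidablePred p] (M : Matrix ι ι ℂ) :
    ‖(Matrix.diagonal (fun i => if p i then (1 : ℂ) else 0) * M).trace‖ ≤ ((univ.filter p).card : ℝ) * ‖M‖ := by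
  rw [Matrix.trace]
  simp only [Matrix.diag_apply, Matrix.diagonal_mul]
  calc ‖∑ i, (if p i then (1 : ℂ) else 0) * M i i‖
      ≤ ∑ i, ‖(if p i then (1 : ℂ) else 0) * M i i‖ := norm_sum_le _ _
    _ = ∑ i, (if p i then ‖M i i‖ else 0) := by
        refine Finset.sum_congr rfl fun i _ => ?_
        split_ifs <;> simp
    _ ≤ ∑ i, (if p i then ‖M‖ else 0) := by
        refine Finset.sum_le_sum fun i _ => ?_
        split_ifs
        · exact norm_apply_le_l2_opNorm M i i
        · exact le_rfl
    _ = ((univ.filter p).card : ℝ) * ‖M‖ := by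
        rw [← Finset.sum_filter, Finset.sum_const, nsmul_eq_mul]

/-- **Products of steps**: `‖S₁⋯Sₘ‖ ≤ Π‖S_i‖` for a list of matrices (`ℓ²`-operator norm; the empty product is `1`, of norm `≤ 1`). [folklore] -/
theorem norm_list_prod_le (l : List (Matrix ι ι ℂ)) : ‖l.prod‖ ≤ (l.map fun S => ‖S‖).prod := by
  induction l with
  | nil =>
      simp only [List.prod_nil, List.map_nil]
      rw [← Matrix.diagonal_one]
      exact l2_opNorm_diagonal_le _ fun i => by simp
  | cons S l ih =>
      simp only [List.prod_cons, List.map_cons]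
      exact (norm_mul_le _ _).trans (mul_le_mul_of_nonneg_left ih (norm_nonneg _))

end G3CCT

/-! ## At the record: connectivity of walks and the rooted trace bound -/

section Record

variable {F : T4Family}
variable {a₀ δ₀ c₀ γ₀ γ₁ δ₁ : ℝ} {Mc : ℕ} {α₀ α₁ ε₂₉ : ℝ} {k : ℕ}
variable {TC : (n : ℕ) → Sect2.CPair (F.P (recordK₀ F Mc k + n)) (MatA 2) → FluctIdx F k (recordK₀ F Mc k + n) → FluctIdx F k (recordK₀ F Mc k + n) → ℂ}
variable {TY : (n : ℕ) → (recordDomSys F Mc k (recordK₀ F Mc k + n)).Dom → Sect2.CPair (F.P (recordK₀ F Mc k + n)) (MatA 2) →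
  FluctIdx F k (recordK₀ F Mc k + n) → FluctIdx F k (recordK₀ F Mc k + n) → ℂ}
variable {TZY : Finset (Fin 4 → ℤ) → IntBondCfg → ((Fin 4 → ℤ) × Fin 4) × Fin 3 → ((Fin 4 → ℤ) × Fin 4) × Fin 3 → ℂ}
variable {AdM : (n : ℕ) → (Site (F.P (recordK₀ F Mc k + n)) 0 → (MatA 2)ˣ) →
  Matrix (FluctIdx F k (recordK₀ F Mc k + n)) (FluctIdx F k (recordK₀ F Mc k + n)) ℂ}
variable {AdZ : ((Fin 4 → ℤ) → (MatA 2)ˣ) → (Fin 4 → ℤ) × Fin 4 → Matrix (Fin 3) (Fin 3) ℂ}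

/-- **THE SUPPORT RULE `𝟙_□·T_Y = 0` unless `□ ∈ Y`** (row support of the pieces, (P4) support clause in cube form). [cite: Balaban1987RG1, (1.7) p.261] -/
theorem g3cInd_mul_nonB0Block_of_not_mem (hP : P0CarrierClauses F a₀ δ₀ c₀ γ₀ γ₁ Mc α₀ α₁ ε₂₉ k TC TY TZY AdM AdZ) (hMc : McGuard F Mc) (n : ℕ)
    (q : TPt (F.P (recordK₀ F Mc k + n)).d (Sect2.domCount (F.P (recordK₀ F Mc k + n)) Mc (k + 1))) (Y : (recordDomSys F Mc k (recordK₀ F Mc k + n)).Dom)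
    (hq : q ∉ (Y.1 : Finset _)) (φ : Sect2.CPair (F.P (recordK₀ F Mc k + n)) (MatA 2)) :
    g3cInd F Mc k (recordK₀ F Mc k + n) q * nonB0Block F k (recordK₀ F Mc k + n) (TY n Y φ) = 0 := by
  obtain ⟨-, -, -, -, -, -, -, -, hSupp, -⟩ := hP
  have hK : recordK₀ F Mc k ≤ recordK₀ F Mc k + n := Nat.le_add_right _ _
  ext i j
  rw [g3cInd, Matrix.diagonal_mul, Matrix.zero_apply]
  by_cases hi : cubeOfSite F Mc k (recordK₀ F Mc k + n) (blockOf i.1.1.src) = q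
  · have hiY : cubeOfSite F Mc k (recordK₀ F Mc k + n) (blockOf i.1.1.src) ∉ (Y.1 : Finset _) := by rw [hi]; exact hq
    rw [nonB0Block, Matrix.of_apply, fluct_supp_of_cube hMc hK (hSupp n) Y φ i j (Or.inl hiY), mul_zero]
  · rw [if_neg hi]; simp

/-- **Connectivity of walks**: `𝟙_□·S_{□′,Y} = 0` unless `□ ∈ Y` — consecutive steps `S_{□_{i−1},Y_{i−1}}·S_{□_i,Y_i}` (the former ending in `𝟙_{□_{i−1}}`) vanish unless `□_{i−1} ∈ Y_i`.
[cite: Balaban1985BackgroundPropagators, (3.90) p.409 («localized random walk»)] -/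
theorem g3cInd_mul_g3cStep_of_not_mem (hP : P0CarrierClauses F a₀ δ₀ c₀ γ₀ γ₁ Mc α₀ α₁ ε₂₉ k TC TY TZY AdM AdZ) (hMc : McGuard F Mc) (n : ℕ)
    (q q' : TPt (F.P (recordK₀ F Mc k + n)).d (Sect2.domCount (F.P (recordK₀ F Mc k + n)) Mc (k + 1))) (Y : (recordDomSys F Mc k (recordK₀ F Mc k + n)).Dom)
    (hq : q ∉ (Y.1 : Finset _)) (x : ℝ) (φ : Sect2.CPair (F.P (recordK₀ F Mc k + n)) (MatA 2)) :
    g3cInd F Mc k (recordK₀ F Mc k + n) q * g3cStep F Mc k (recordK₀ F Mc k + n) (TY n) q' Y x φ = 0 := by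
  rw [g3cStep, ← Matrix.mul_assoc, ← Matrix.mul_assoc, ← Matrix.mul_assoc, g3cInd_mul_nonB0Block_of_not_mem hP hMc n q Y hq φ]
  simp

/-- `𝟙_□` is idempotent. [folklore] -/
theorem g3cInd_mul_g3cInd (Mc k K : ℕ) (q : TPt (F.P K).d (Sect2.domCount (F.P K) Mc (k + 1))) :
    g3cInd F Mc k K q * g3cInd F Mc k K q = g3cInd F Mc k K q := by
  rw [g3cInd, Matrix.diagonal_mul_diagonal]
  congr 1; ext i
  split_ifs <;> simp

/-- A step ends in its cube: `S_{□,Y}·𝟙_□ = S_{□,Y}`. [folklore] -/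
theorem g3cStep_mul_g3cInd (Mc k K : ℕ) (TYK : (recordDomSys F Mc k K).Dom → Sect2.CPair (F.P K) (MatA 2) → FluctIdx F k K → FluctIdx F k K → ℂ)
    (q : TPt (F.P K).d (Sect2.domCount (F.P K) Mc (k + 1))) (Y : (recordDomSys F Mc k K).Dom) (x : ℝ) (φ : Sect2.CPair (F.P K) (MatA 2)) :
    g3cStep F Mc k K TYK q Y x φ * g3cInd F Mc k K q = g3cStep F Mc k K TYK q Y x φ := by
  rw [g3cStep, Matrix.mul_assoc, g3cInd_mul_g3cInd]

/-- ★ **THE ROOTED TRACE BOUND**: `|Tr[G_{□₀}(x,φ)·𝟙_{□₀}·M]| ≤ N_□ · (1∕γ₀) · ‖M‖`, `N_□ = 3d(L·Mc)^d` (cyclicity, `#{indices in □₀} ≤ N_□` ✓`card_filter_cube_le`, entries `≤` operator norm,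
`‖G_{□₀}‖ ≤ 1∕γ₀` ✓`l2_opNorm_g3cLocInv_le`); `x ≥ 0`, `φ` in the record space of `□̃₀`. [cite: Balaban1985UV3, (25) p.262; Balaban1985BackgroundPropagators, (3.96) p.411] -/
theorem norm_trace_root_mul_le (hP : P0CarrierClauses F a₀ δ₀ c₀ γ₀ γ₁ Mc α₀ α₁ ε₂₉ k TC TY TZY AdM AdZ) (hMc : McGuard F Mc) (hγ₀ : 0 < γ₀) (n : ℕ)
    (q₀ : TPt (F.P (recordK₀ F Mc k + n)).d (Sect2.domCount (F.P (recordK₀ F Mc k + n)) Mc (k + 1))) {φ : Sect2.CPair (F.P (recordK₀ F Mc k + n)) (MatA 2)}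
    (hφ : encodeCfg F (recordK₀ F Mc k + n) φ ∈ recordUc F Mc k α₀ α₁ (recordK₀ F Mc k + n) (g3cBlk F Mc k (recordK₀ F Mc k + n) q₀)) {x : ℝ} (hx : 0 ≤ x)
    (M : Matrix (NonB0Idx F k (recordK₀ F Mc k + n)) (NonB0Idx F k (recordK₀ F Mc k + n)) ℂ) :
    ‖(g3cLocInv F Mc k (recordK₀ F Mc k + n) (TY n) (g3cBlk F Mc k (recordK₀ F Mc k + n) q₀) x φ * g3cInd F Mc k (recordK₀ F Mc k + n) q₀ * M).trace‖ ≤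
      (3 * (F.P (recordK₀ F Mc k + n)).d * (F.L * Mc) ^ (F.P (recordK₀ F Mc k + n)).d : ℕ) * (1 / γ₀) * ‖M‖ := by
  have hK : recordK₀ F Mc k ≤ recordK₀ F Mc k + n := Nat.le_add_right _ _
  set G := g3cLocInv F Mc k (recordK₀ F Mc k + n) (TY n) (g3cBlk F Mc k (recordK₀ F Mc k + n) q₀) x φ with hGdef
  have hG : ‖G‖ ≤ 1 / γ₀ := l2_opNorm_g3cLocInv_le hP hγ₀ n _ hφ hx
  rw [Matrix.mul_assoc, Matrix.trace_mul_comm, g3cInd]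
  have hcast : (fun i : NonB0Idx F k (recordK₀ F Mc k + n) => (((if cubeOfSite F Mc k (recordK₀ F Mc k + n) (blockOf i.1.1.src) = q₀ then (1 : ℝ) else 0 : ℝ)) : ℂ)) =
      fun i => if cubeOfSite F Mc k (recordK₀ F Mc k + n) (blockOf i.1.1.src) = q₀ then (1 : ℂ) else 0 := by
    funext i; split_ifs <;> simp
  rw [hcast, Matrix.mul_assoc]
  refine (G3CCT.norm_trace_diagonal_mul_le _ _).trans ?_
  have hcnt : ((univ.filter fun i : NonB0Idx F k (recordK₀ F Mc k + n) => cubeOfSite F Mc k (recordK₀ F Mc k + n) (blockOf i.1.1.src) = q₀).card : ℝ) ≤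
      (3 * (F.P (recordK₀ F Mc k + n)).d * (F.L * Mc) ^ (F.P (recordK₀ F Mc k + n)).d : ℕ) := by
    exact_mod_cast card_filter_cube_le hMc hK q₀
  have hMG : ‖M * G‖ ≤ ‖M‖ * (1 / γ₀) := (norm_mul_le _ _).trans (mul_le_mul_of_nonneg_left hG (norm_nonneg _))
  calc ((univ.filter fun i : NonB0Idx F k (recordK₀ F Mc k + n) => cubeOfSite F Mc k (recordK₀ F Mc k + n) (blockOf i.1.1.src) = q₀).card : ℝ) * ‖M * G‖
      ≤ (3 * (F.P (recordK₀ F Mc k + n)).d * (F.L * Mc) ^ (F.P (recordK₀ F Mc k + n)).d : ℕ) * (‖M‖ * (1 / γ₀)) :=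
        mul_le_mul hcnt hMG (norm_nonneg _) (by positivity)
    _ = _ := by ring

/-- ★ **THE WALK-TERM MAJORANT**: `|t_ω(x,φ)| = |Tr[G_{□₀}𝟙_{□₀}·S₁⋯Sₘ]| ≤ N_□·(1∕γ₀)·Π_i ‖S_i‖` for any list of steps. [cite: Balaban1985UV3, (25) p.262; Balaban1985BackgroundPropagators, (3.96) p.411] -/
theorem norm_trace_root_mul_prod_le (hP : P0CarrierClauses F a₀ δ₀ c₀ γ₀ γ₁ Mc α₀ α₁ ε₂₉ k TC TY TZY AdM AdZ) (hMc : McGuard F Mc) (hγ₀ : 0 < γ₀) (n : ℕ)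
    (q₀ : TPt (F.P (recordK₀ F Mc k + n)).d (Sect2.domCount (F.P (recordK₀ F Mc k + n)) Mc (k + 1))) {φ : Sect2.CPair (F.P (recordK₀ F Mc k + n)) (MatA 2)}
    (hφ : encodeCfg F (recordK₀ F Mc k + n) φ ∈ recordUc F Mc k α₀ α₁ (recordK₀ F Mc k + n) (g3cBlk F Mc k (recordK₀ F Mc k + n) q₀)) {x : ℝ} (hx : 0 ≤ x)
    (l : List (Matrix (NonB0Idx F k (recordK₀ F Mc k + n)) (NonB0Idx F k (recordK₀ F Mc k + n)) ℂ)) :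
    ‖(g3cLocInv F Mc k (recordK₀ F Mc k + n) (TY n) (g3cBlk F Mc k (recordK₀ F Mc k + n) q₀) x φ * g3cInd F Mc k (recordK₀ F Mc k + n) q₀ * l.prod).trace‖ ≤
      (3 * (F.P (recordK₀ F Mc k + n)).d * (F.L * Mc) ^ (F.P (recordK₀ F Mc k + n)).d : ℕ) * (1 / γ₀) * (l.map fun S => ‖S‖).prod :=
  (norm_trace_root_mul_le hP hMc hγ₀ n q₀ hφ hx _).trans (mul_le_mul_of_nonneg_left (G3CCT.norm_list_prod_le l) (by positivity))

end Record

end Summit.QuantumFields.YangMills.Theorems.BalabanUVNodesPortS1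

end
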